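import Mathlib
import Summits.MatrixMultiplication.Statement
import Summits.MatrixMultiplication.MatrixMultiplication.Theses.NOFWindowCapacity

/-!
# Crux `Thesis` (stmt-MatrixMultiplication-7270) — `Lines/integer-seed.lean` (strategist's alternative line)

Route `NOFWindowCapacity`, crux `Thesis` (for every `ε > 0`: an abelian host `G`, legs `s t u : Fin N → G`, `N ≥ 2`,
and a PARTITION of the `N³` matrix-multiplication triples into `B` alien-free boxes with `B·|G| ≤ N^(2+ε)`).

LINE `integer-seed` = HOST ELIMINATION + SPECTRUM AMPLIFICATION.  The host `G` is removed from the problem: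

* An INTEGER SEED is the same combinatorial datum (legs, `B` boxes partitioning `[N]³`, every box alien-free) but with
  legs valued in the free abelian group `ℤ^d` (no host to choose, no modulus), priced not by a group order but by the
  size `K` of its SPECTRUM `A = ⋃_r {x_b + y_c − z_a : a ∈ P_r, b ∈ Q_r, c ∈ R_r} ⊆ ℤ^d` — the box-restricted triple
  sumset `⋃_r (X_r + Y_r − Z_r)` of the label sets (`x_{ij} = t_j − s_i`, `y_{jk} = u_k − t_j`, `z_{ik} = u_k − s_i`).
  Alien-freeness says exactly that `0 ∈ A` is represented only by matrix-multiplication triples.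
* `stub_seedFamily` (OPEN, the whole bet): for every `ε > 0` an integer seed with `B·K ≤ N^(2+ε)`.
* `stub_seedMul` (TRUE, size M–L): seeds multiply — the tensor product of two seeds (index pairs, concatenated legs
  `Fin.append`, product boxes) is a seed with parameters `(d₁+d₂, N₁N₂, B₁B₂, K₁K₂, E)`: alien-freeness, the partition
  property and the entry bound are componentwise, and the spectrum of the product lies in `A₁ × A₂`.
* `stub_seedQuotient` (TRUE, size M): a seed with spectrum size `≤ K < M` and leg entries `≤ E`, `6E < M`, `M` prime,
  has a quotient in the cyclic host `ZMod M` with the SAME boxes: a uniformly random functional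
  `φ(v) = Σ_l λ_l v_l : ℤ^d → ZMod M` kills a fixed non-zero spectrum vector (whose entries are `≤ 6E < M` in absolute
  value, hence non-zero mod `M`) with probability exactly `1/M`, and there are `< M` of them (union bound); `φ ∘ legs`
  is then alien-free in `ZMod M` because an alien there is a spectrum vector in `ker φ`, i.e. `0`, i.e. legit.
* `Thesis_of` (REAL proof): seed at `ε/2` ↦ `p`-th power (induction on `stub_seedMul`) ↦ Bertrand prime
  `M ∈ (max(K^p, 6E+1), 2·max]` ↦ `stub_seedQuotient` ↦ a `Thesis` witness at `N^p` in `ZMod M` with cost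
  `B^p·M ≤ 2(6E+1)(BK)^p ≤ 2(6E+1)·N^{p(2+ε/2)} ≤ (N^p)^(2+ε)` once `N^{pε/2} ≥ 2(6E+1)` (`pow_unbounded_of_one_lt`).

Consequence recorded on the card: `ω ≤ log_N(B·K)` for every integer seed; conversely a finite instance in a CYCLIC host
`ℤ_M` lifts to an integer seed with `K ≤ 6M` (labels in `(−M, M)`), so for hosts of rank `o(log N)` nothing is lost:
the host quantifier of `Thesis` is inessential and the crux is a pure additive-combinatorial design problem in `ℤ`
(indeed `d = 1` suffices for existence, by a generic projection `ℤ^d → ℤ` injective on the spectrum).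

Disproof used: no `Disproof.lean`, no `_false_without_` theorem and no landed `Negative/` lemma exist for this crux
(`ledger crux ls stmt-MatrixMultiplication-7270`, 2026-08-17); `ledger negatives --problem MatrixMultiplication` has
nothing on alien-free partitions.  In-route refuting driver: `WindowCapacityGap → ¬Thesis` (proved `GapKillsThesis`);
it would refute `stub_seedFamily` through `stub_seedMul` + `stub_seedQuotient` (a seed family IS a Thesis family).
-/

set_option linter.dupNamespace false
set_option linter.unusedVariables false

namespace Summit.MatrixMultiplication.MatrixMultiplication.Cruxes.Thesis.IntegerSeed

open Summit.MatrixMultiplication.MatrixMultiplication.Theses.NOFWindowCapacity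

/-- Alien-freeness of one box `(P, Q, R)` for legs `s t u : Fin N → G` — verbatim the route's per-box clause, over an
arbitrary additive commutative group (here used with `G = ℤ^d` and `G = ZMod M`). -/
def AlienFree {G : Type} [AddCommGroup G] {N : ℕ} (s t u : Fin N → G) (P Q R : Finset (Fin N × Fin N)) : Prop :=
  ∀ a ∈ P, ∀ b ∈ Q, ∀ c ∈ R, (t b.2 - s b.1) + (u c.2 - t c.1) = u a.2 - s a.1 → a.1 = b.1 ∧ b.2 = c.1 ∧ a.2 = c.2

/-- The `B` boxes partition the `N³` matrix-multiplication triples — verbatim the route's `∃!` clause. -/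
def Partitions {N B : ℕ} (P Q R : Fin B → Finset (Fin N × Fin N)) : Prop :=
  ∀ i j k : Fin N, ∃! r : Fin B, (i, k) ∈ P r ∧ (i, j) ∈ Q r ∧ (j, k) ∈ R r

/-- The SPECTRUM of a box family: all values `x_b + y_c − z_a` (`x_b = t b.2 − s b.1`, `y_c = u c.2 − t c.1`,
`z_a = u a.2 − s a.1`) over all boxes `r` and all `(a, b, c) ∈ P_r × Q_r × R_r`; i.e. `⋃_r (X_r + Y_r − Z_r)`. -/
noncomputable def spectrum {G : Type} [AddCommGroup G] [DecidableEq G] {N B : ℕ} (s t u : Fin N → G)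
    (P Q R : Fin B → Finset (Fin N × Fin N)) : Finset G :=
  Finset.univ.biUnion fun r : Fin B => ((P r) ×ˢ (Q r) ×ˢ (R r)).image
    (fun abc => (t abc.2.1.2 - s abc.2.1.1) + (u abc.2.2.2 - t abc.2.2.1) - (u abc.1.2 - s abc.1.1))

/-- INTEGER SEED with parameters `(d, N, B, K, E)`: legs `Fin N → ℤ^d` with entries bounded by `E`, `B` boxes
partitioning `[N]³`, every box alien-free over `ℤ^d`, spectrum of size at most `K`.  No host, no modulus. -/
def IntSeed (d N B K E : ℕ) : Prop :=
  ∃ (s t u : Fin N → (Fin d → ℤ)) (P Q R : Fin B → Finset (Fin N × Fin N)),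
    (∀ r, AlienFree s t u (P r) (Q r) (R r)) ∧ Partitions P Q R ∧
    (spectrum s t u P Q R).card ≤ K ∧
    (∀ i l, |s i l| ≤ (E : ℤ) ∧ |t i l| ≤ (E : ℤ) ∧ |u i l| ≤ (E : ℤ))

/-! ## The three statements of the line (named), their registered stubs, and name-keyed aliases -/

/-- Statement of stub 1 (OPEN): an integer seed family with `B·K ≤ N^(2+ε)` for every `ε > 0`. -/
def SeedFamily : Prop :=
  ∀ ε : ℝ, 0 < ε → ∃ d N B K E : ℕ, 2 ≤ N ∧ IntSeed d N B K E ∧ ((B * K : ℕ) : ℝ) ≤ (N : ℝ) ^ (2 + ε)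

/-- Statement of stub 2 (TRUE): seeds multiply. -/
def SeedMul : Prop :=
  ∀ d₁ N₁ B₁ K₁ d₂ N₂ B₂ K₂ E : ℕ, IntSeed d₁ N₁ B₁ K₁ E → IntSeed d₂ N₂ B₂ K₂ E →
    IntSeed (d₁ + d₂) (N₁ * N₂) (B₁ * B₂) (K₁ * K₂) E

/-- Statement of stub 3 (TRUE): prime quotient of a seed into `ZMod M`. -/
def SeedQuotient : Prop :=
  ∀ d N B K E M : ℕ, IntSeed d N B K E → M.Prime → K < M → 6 * E < M →
    ∃ (s t u : Fin N → ZMod M) (P Q R : Fin B → Finset (Fin N × Fin N)),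
      (∀ r, AlienFree s t u (P r) (Q r) (R r)) ∧ Partitions P Q R

/-- STUB 1 (OPEN — the bet of the line, host-free form of the crux): for every `ε > 0` there is an integer seed whose
number of boxes times spectrum size is at most `N^(2+ε)` (`N ≥ 2`). -/
theorem stub_seedFamily :
    ∀ ε : ℝ, 0 < ε → ∃ d N B K E : ℕ, 2 ≤ N ∧ IntSeed d N B K E ∧ ((B * K : ℕ) : ℝ) ≤ (N : ℝ) ^ (2 + ε) := by
  sorry

/-- STUB 2 (TRUE, supermultiplicativity): the tensor product of two integer seeds is an integer seed — indices
`Fin (N₁N₂) ≃ Fin N₁ × Fin N₂`, legs `Fin.append (s₁ i₁) (s₂ i₂) : Fin (d₁+d₂) → ℤ`, boxes `Fin (B₁B₂) ≃ Fin B₁ × Fin B₂`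
with `P (r₁,r₂) = {((i₁,i₂),(k₁,k₂)) : (i₁,k₁) ∈ P₁ r₁ ∧ (i₂,k₂) ∈ P₂ r₂}` etc.; alien-freeness, partition and entry
bound hold componentwise and the spectrum embeds into `A₁ × A₂`. -/
theorem stub_seedMul :
    ∀ d₁ N₁ B₁ K₁ d₂ N₂ B₂ K₂ E : ℕ, IntSeed d₁ N₁ B₁ K₁ E → IntSeed d₂ N₂ B₂ K₂ E →
      IntSeed (d₁ + d₂) (N₁ * N₂) (B₁ * B₂) (K₁ * K₂) E := by
  sorry

/-- STUB 3 (TRUE, prime quotient by a random functional): an integer seed with spectrum size `< M` and entries `≤ E`,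
`6E < M`, `M` prime, descends to the cyclic host `ZMod M` with `B` alien-free boxes still partitioning `[N]³`
(legs `φ ∘ s, φ ∘ t, φ ∘ u` for a functional `φ : ℤ^d → ZMod M` non-vanishing on the non-zero spectrum; such `φ`
exists by counting: each of the `< M` non-zero spectrum vectors is non-zero mod `M` and is killed by exactly `M^(d-1)`
of the `M^d` functionals). -/
theorem stub_seedQuotient :
    ∀ d N B K E M : ℕ, IntSeed d N B K E → M.Prime → K < M → 6 * E < M →
      ∃ (s t u : Fin N → ZMod M) (P Q R : Fin B → Finset (Fin N × Fin N)),
        (∀ r, AlienFree s t u (P r) (Q r) (R r)) ∧ Partitions P Q R := by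
  sorry

/-! ### Consistency: each named statement IS its registered stub (definitionally) -/

theorem seedFamily_holds : SeedFamily := stub_seedFamily
theorem seedMul_holds : SeedMul := stub_seedMul
theorem seedQuotient_holds : SeedQuotient := stub_seedQuotient

/-! ### Name-keyed aliases of the three statements (the hypotheses of the composition) -/
namespace Registered

/-- Alias of `SeedFamily` keyed by the registered stub name. -/
abbrev stub_seedFamily : Prop := SeedFamily
/-- Alias of `SeedMul` keyed by the registered stub name. -/
abbrev stub_seedMul : Prop := SeedMul
/-- Alias of `SeedQuotient` keyed by the registered stub name. -/
abbrev stub_seedQuotient : Prop := SeedQuotient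

end Registered

/-- COMPOSITION (real proof, no `sorry` of its own; the ONLY theorem of this file concluding the crux): the three
registered stubs imply the crux `Thesis` BY NAME.  Seed at `ε/2` ↦ powers ↦ Bertrand prime ↦ quotient ↦ cost bookkeeping. -/
theorem Thesis_of (h1 : Registered.stub_seedFamily) (h2 : Registered.stub_seedMul)
    (h3 : Registered.stub_seedQuotient) :
    Thesis := by
  intro ε hε
  obtain ⟨d, N, B, K, E, hN, hseed, hcost⟩ := h1 (ε / 2) (by positivity)
  -- (0) the spectrum of a seed with `N ≥ 1` is non-empty, so `K ≥ 1`
  have hK : 1 ≤ K := by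
    obtain ⟨s, t, u, P, Q, R, -, hPart, hcard, -⟩ := hseed
    have h0 : 0 < N := by omega
    obtain ⟨r, hr, -⟩ := hPart ⟨0, h0⟩ ⟨0, h0⟩ ⟨0, h0⟩
    have hne : (spectrum s t u P Q R).Nonempty := by
      unfold spectrum
      refine ⟨_, Finset.mem_biUnion.mpr ⟨r, Finset.mem_univ _, Finset.mem_image.mpr
        ⟨((⟨0, h0⟩, ⟨0, h0⟩), ((⟨0, h0⟩, ⟨0, h0⟩), (⟨0, h0⟩, ⟨0, h0⟩))), ?_, rfl⟩⟩⟩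
      simp only [Finset.mem_product]
      exact ⟨hr.1, hr.2.1, hr.2.2⟩
    exact le_trans (Finset.card_pos.mpr hne) hcard
  -- (1) powers of the seed, by induction on `stub_seedMul`
  have hpow : ∀ m : ℕ, IntSeed (d * (m + 1)) (N ^ (m + 1)) (B ^ (m + 1)) (K ^ (m + 1)) E := by
    intro m
    induction m with
    | zero => simpa using hseed
    | succ m ih =>
      have h := h2 _ _ _ _ _ _ _ _ _ ih hseed
      simpa [Nat.mul_succ, pow_succ] using h
  -- (2) choose the power `p = n + 1` with `N^(p ε/2) > 2(6E+1)`
  set x : ℝ := (N : ℝ) with hx_def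
  have hx1 : (1 : ℝ) < x := by rw [hx_def]; exact_mod_cast hN
  have hx0 : (0 : ℝ) ≤ x := by linarith
  have hy1 : (1 : ℝ) < x ^ (ε / 2) := Real.one_lt_rpow hx1 (by positivity)
  obtain ⟨n, hn⟩ := pow_unbounded_of_one_lt ((2 : ℝ) * (6 * E + 1)) hy1
  set p : ℕ := n + 1 with hp_def
  have hp0 : p ≠ 0 := by omega
  have hyp : (2 : ℝ) * (6 * E + 1) ≤ (x ^ (ε / 2)) ^ p := by
    have hmono : (x ^ (ε / 2)) ^ n ≤ (x ^ (ε / 2)) ^ p :=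
      pow_le_pow_right₀ hy1.le (by omega)
    exact (hn.le).trans hmono
  have hseedp : IntSeed (d * p) (N ^ p) (B ^ p) (K ^ p) E := hpow n
  -- (3) a Bertrand prime above `L = max (K^p) (6E+1)`
  set L : ℕ := max (K ^ p) (6 * E + 1) with hL_def
  have hL0 : L ≠ 0 := by
    have : 1 ≤ 6 * E + 1 := by omega
    have : 6 * E + 1 ≤ L := le_max_right _ _
    omega
  obtain ⟨M, hMprime, hLM, hM2L⟩ := Nat.exists_prime_lt_and_le_two_mul L hL0
  have hKM : K ^ p < M := lt_of_le_of_lt (le_max_left _ _) hLM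
  have hEM : 6 * E < M := by
    have : 6 * E + 1 ≤ L := le_max_right _ _
    omega
  -- (4) the quotient instance in `ZMod M`
  obtain ⟨s, t, u, P, Q, R, hAF, hPart⟩ := h3 _ _ _ _ _ _ hseedp hMprime hKM hEM
  haveI : NeZero M := ⟨hMprime.ne_zero⟩
  refine ⟨N ^ p, ?_, ZMod M, inferInstance, inferInstance, s, t, u, B ^ p, P, Q, R, ?_, ?_, ?_⟩
  · exact le_trans hN (Nat.le_self_pow hp0 N)
  · intro r
    exact hAF r
  · exact hPart
  · -- cost: `B^p · M ≤ 2(6E+1)·(BK)^p ≤ (x^(ε/2))^p · (x^(2+ε/2))^p = (x^p)^(2+ε)`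
    rw [ZMod.card M]
    push_cast
    have hKp1 : 1 ≤ K ^ p := Nat.one_le_pow _ _ hK
    have hE1 : 1 ≤ 6 * E + 1 := by omega
    have hLle : L ≤ K ^ p * (6 * E + 1) :=
      max_le (Nat.le_mul_of_pos_right _ (by omega)) (Nat.le_mul_of_pos_left _ (by omega))
    have hMle : (M : ℝ) ≤ 2 * ((6 * E + 1) * (K : ℝ) ^ p) := by
      have h : M ≤ 2 * (K ^ p * (6 * E + 1)) := hM2L.trans (Nat.mul_le_mul_left 2 hLle)
      have h' : (M : ℝ) ≤ ((2 * (K ^ p * (6 * E + 1)) : ℕ) : ℝ) := by exact_mod_cast h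
      push_cast at h'
      linarith [h']
    have hBK : (B : ℝ) * (K : ℝ) ≤ x ^ (2 + ε / 2) := by
      have h : ((B * K : ℕ) : ℝ) ≤ (N : ℝ) ^ (2 + ε / 2) := hcost
      push_cast at h
      simpa [hx_def] using h
    have hBKp : ((B : ℝ) * (K : ℝ)) ^ p ≤ (x ^ (2 + ε / 2)) ^ p :=
      pow_le_pow_left₀ (by positivity) hBK p
    have hB0 : (0 : ℝ) ≤ (B : ℝ) ^ p := by positivity
    calc (B : ℝ) ^ p * (M : ℝ)
        ≤ (B : ℝ) ^ p * (2 * ((6 * E + 1) * (K : ℝ) ^ p)) := mul_le_mul_of_nonneg_left hMle hB0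
      _ = (2 * (6 * (E : ℝ) + 1)) * (((B : ℝ) * (K : ℝ)) ^ p) := by ring
      _ ≤ (x ^ (ε / 2)) ^ p * (x ^ (2 + ε / 2)) ^ p :=
          mul_le_mul hyp hBKp (by positivity) (by positivity)
      _ = (x ^ (ε / 2) * x ^ (2 + ε / 2)) ^ p := (mul_pow _ _ _).symm
      _ = (x ^ (2 + ε)) ^ p := by
          rw [← Real.rpow_add (by linarith) (ε / 2) (2 + ε / 2)]
          ring_nf
      _ = (x ^ p) ^ (2 + ε) := by
          rw [← Real.rpow_mul_natCast hx0, ← Real.rpow_natCast_mul hx0]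
          ring_nf

/-- Wiring check: the registered stubs feed `Thesis_of` as stated (an `example`, so that `Thesis_of` stays the only
theorem concluding the crux; `closed = false` only through the three `stub_*`). -/
example : Thesis := Thesis_of stub_seedFamily stub_seedMul stub_seedQuotient

end Summit.MatrixMultiplication.MatrixMultiplication.Cruxes.Thesis.IntegerSeed
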